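import Summits.NavierStokesRegularity.NavierStokesRegularity.Theorems.HodographBetchovSlowClassProductionOfNearField

/-!
# `SlowClassProduction` (stmt-NavierStokesRegularity-15831) — the crux as a germ budget at singular points

Route `HodographBetchov`, crux 2, line `near_field`.  The line's open stub
`stub_nearFieldSlowProductionMaximal` asks for the absolute production budget of the slow class
inside a near-field final layer `{T − h ≤ s} × {‖x‖ < R}` of a maximal smooth solution.  This file
proves that only the GERMS AT SINGULAR POINTS of the blow-up time matter:

* `germBudget_of_cylinderBound` — at a point `x₀` that is regular at time `T` (the velocity is
  essentially bounded on some backward cylinder `Q_r(T, x₀)`), the production is absolutely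
  integrable, uniformly in `t < T`, on the slow class inside the germ region
  `{T − ρ ≤ s} × B(x₀, ρ)` for some `ρ > 0`: continuity makes the bound pointwise, Serrin's
  quantitative interior bound (`Birth.norm_curl_le_of_slow_cylinder`, at the level of that bound and
  a cylinder radius `ρ₀ ≤ min (r/2) (ν r/2)`) bounds the vorticity on the germ region, and
  vorticity-bounded sets carry an absolute budget (`NearField.stub_curlBoundedProduction`);
* `nearFieldBudget_of_singularGermBudget` — PER SOLUTION and level: absolute germ budgets at the
  singular points `x₀` (those with `‖u‖_{L^∞(Q_r(T,x₀))} = ∞` for all small `r`) that are moreover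
  `l`-slow-accumulating (every germ region meets the slow class; otherwise the budget is `0`) give the
  near-field budgets for all `(h, R)` (compactness of `B̄(0,R)`: a finite subcover by germ balls, the
  early layer below the least germ depth paid by `Birth.stub_slabProduction`, a finite-union budget);
* `slowClassProduction_of_singularGermBudget : (singular-germ budget for maximal solutions) →
  SlowClassProduction` (with `slowClassProduction_of_nearFieldBudget`).

So the crux follows from (and its absolute form is equivalent, solution by solution, to): at every
singular point `(x₀, T)` of a first blow-up time which is a limit of near-stagnation points
`|u| ≤ l`, some parabolic germ of the slow class has finite absolute enstrophy production.  (By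
`exists_singularPoint_of_classical_of_not_hasSmoothExtensionPast` singular points exist for maximal
solutions, so the hypothesis is not vacuous.)  The converse restriction and the packaged
equivalence live in `HodographBetchovSlowClassProductionGermIff.lean`.
-/

noncomputable section

-- the summit and its single problem share the name `NavierStokesRegularity` (D-0017 nested layout)
set_option linter.dupNamespace false

namespace Summit.NavierStokesRegularity.NavierStokesRegularity.Theorems.SlowClassProduction.NearField

open Set MeasureTheory Function Metric Filter Topology Literature.Analysis.FluidPDE
open scoped ENNReal NNReal

/-! ## Measure theory: finite unions of budgeted pieces -/

/-- Subadditivity of the integral of a nonnegative function over a union with a measurable second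
piece. [folklore] -/
theorem setIntegral_union_le_add {X : Type*} [MeasurableSpace X] {μ : Measure X} {f : X → ℝ}
    {A B : Set X} (hB : MeasurableSet B) (hA : IntegrableOn f A μ) (hBi : IntegrableOn f B μ)
    (hf : ∀ x, 0 ≤ f x) :
    ∫ x in A ∪ B, f x ∂μ ≤ (∫ x in A, f x ∂μ) + ∫ x in B, f x ∂μ := by
  have hU : IntegrableOn f (A ∪ B) μ := hA.union hBi
  rw [← integral_inter_add_sdiff hB hU]
  have h1 : ∫ x in (A ∪ B) ∩ B, f x ∂μ ≤ ∫ x in B, f x ∂μ :=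
    setIntegral_mono_set hBi (ae_of_all _ hf) (inter_subset_right).eventuallyLE
  have hsub : (A ∪ B) \ B ⊆ A := by
    intro x hx
    rcases hx.1 with h | h
    · exact h
    · exact absurd h hx.2
  have h2 : ∫ x in (A ∪ B) \ B, f x ∂μ ≤ ∫ x in A, f x ∂μ :=
    setIntegral_mono_set hA (ae_of_all _ hf) hsub.eventuallyLE
  linarith

/-- **Finite-union budget.**  If `g` is integrable on each of finitely many measurable pieces, it is
integrable on their union and `∫_{⋃} |g| ≤ Σ ∫_{piece} |g|`. [folklore] -/
theorem integrableOn_biUnion_finset_budget {X ι : Type*} [MeasurableSpace X] {μ : Measure X}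
    {g : X → ℝ} (F : Finset ι) (A : ι → Set X) (hA : ∀ i, MeasurableSet (A i))
    (hI : ∀ i ∈ F, IntegrableOn g (A i) μ) :
    IntegrableOn g (⋃ i ∈ F, A i) μ ∧
      ∫ x in ⋃ i ∈ F, A i, |g x| ∂μ ≤ ∑ i ∈ F, ∫ x in A i, |g x| ∂μ := by
  classical
  induction F using Finset.induction_on with
  | empty => simp
  | insert a s ha ih =>
    have hIs : ∀ i ∈ s, IntegrableOn g (A i) μ := fun i hi => hI i (Finset.mem_insert_of_mem hi)
    have hIa : IntegrableOn g (A a) μ := hI a (Finset.mem_insert_self a s)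
    obtain ⟨hint, hle⟩ := ih hIs
    rw [Finset.set_biUnion_insert, Finset.sum_insert ha]
    refine ⟨hIa.union hint, ?_⟩
    have hBm : MeasurableSet (⋃ i ∈ s, A i) := Finset.measurableSet_biUnion s fun i _ => hA i
    calc ∫ x in A a ∪ ⋃ i ∈ s, A i, |g x| ∂μ
        ≤ (∫ x in A a, |g x| ∂μ) + ∫ x in ⋃ i ∈ s, A i, |g x| ∂μ :=
          setIntegral_union_le_add hBm hIa.abs hint.abs fun x => abs_nonneg _
      _ ≤ (∫ x in A a, |g x| ∂μ) + ∑ i ∈ s, ∫ x in A i, |g x| ∂μ := by linarith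

/-! ## Continuity: essential bounds are pointwise, slow classes are measurable -/

/-- An essentially bounded velocity on an open space-time set inside `[0,T) × ℝ³`, continuous there,
is pointwise bounded on that set. [folklore] -/
theorem exists_forall_norm_le_of_eLpNorm_lt_top
    {u : ℝ → EuclideanSpace ℝ (Fin 3) → EuclideanSpace ℝ (Fin 3)}
    {O : Set (ℝ × EuclideanSpace ℝ (Fin 3))} (hO : IsOpen O)
    (hcont : ContinuousOn (uncurry u) O)
    (hbd : eLpNorm (uncurry u) ∞ (volume.restrict O) < ∞) :
    ∃ M : ℝ, ∀ z ∈ O, ‖uncurry u z‖ ≤ M := by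
  set M : ℝ := (eLpNorm (uncurry u) ∞ (volume.restrict O)).toReal with hM_def
  have hMeq : eLpNorm (uncurry u) ∞ (volume.restrict O) = ENNReal.ofReal M := by
    rw [hM_def, ENNReal.ofReal_toReal hbd.ne]
  have hae : ∀ᵐ z ∂(volume.restrict O), ‖uncurry u z‖ ≤ M := by
    have h1 : ∀ᵐ z ∂(volume.restrict O), ‖uncurry u z‖ₑ ≤ ENNReal.ofReal M := by
      refine (ae_le_eLpNormEssSup (f := uncurry u)).mono fun z hz => hz.trans ?_
      rw [← eLpNorm_exponent_top, hMeq]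
    filter_upwards [h1] with z hz
    rw [← ofReal_norm] at hz
    exact (ENNReal.ofReal_le_ofReal_iff ENNReal.toReal_nonneg).1 hz
  exact ⟨M, Birth.forall_le_of_ae_restrict_le hO hcont.norm hae⟩

/-- The slow class `{0 < s < t, |u(s,x)| ≤ l}`, `t ≤ T`, of a velocity continuous on `[0,T) × ℝ³`
is measurable (a sublevel set cut to the open slab `(0,t) × ℝ³`). [folklore] -/
theorem measurableSet_slowClass {u : ℝ → EuclideanSpace ℝ (Fin 3) → EuclideanSpace ℝ (Fin 3)}
    {T t l : ℝ} (htT : t ≤ T)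
    (hU : ContinuousOn (uncurry u) (Set.Ico 0 T ×ˢ (Set.univ : Set (EuclideanSpace ℝ (Fin 3))))) :
    MeasurableSet {z : ℝ × EuclideanSpace ℝ (Fin 3) | z.1 ∈ Set.Ioo 0 t ∧ ‖u z.1 z.2‖ ≤ l} := by
  have hsub : Ioo 0 t ×ˢ (univ : Set (EuclideanSpace ℝ (Fin 3))) ⊆ Ico 0 T ×ˢ univ :=
    prod_mono (fun s hs => ⟨hs.1.le, hs.2.trans_le htT⟩) Subset.rfl
  have hcont : ContinuousOn (fun z : ℝ × EuclideanSpace ℝ (Fin 3) => ‖u z.1 z.2‖)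
      (Ioo 0 t ×ˢ (univ : Set (EuclideanSpace ℝ (Fin 3)))) := (hU.mono hsub).norm
  have heq : {z : ℝ × EuclideanSpace ℝ (Fin 3) | z.1 ∈ Set.Ioo 0 t ∧ ‖u z.1 z.2‖ ≤ l} =
      (Ioo 0 t ×ˢ (univ : Set (EuclideanSpace ℝ (Fin 3)))) ∩
        (fun z : ℝ × EuclideanSpace ℝ (Fin 3) => ‖u z.1 z.2‖) ⁻¹' Iic l := by
    ext z
    simp only [mem_setOf_eq, mem_inter_iff, mem_prod, mem_univ, and_true, mem_preimage, mem_Iic]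
  rw [heq]
  exact measurableSet_inter_preimage_Iic_of_continuousOn (isOpen_Ioo.prod isOpen_univ) hcont l

/-- The germ region `{T − ρ ≤ s} × B(x₀, ρ)` is measurable. [folklore] -/
theorem measurableSet_germ (T ρ : ℝ) (x₀ : EuclideanSpace ℝ (Fin 3)) :
    MeasurableSet {z : ℝ × EuclideanSpace ℝ (Fin 3) | T - ρ ≤ z.1 ∧ dist z.2 x₀ < ρ} :=
  (measurableSet_le measurable_const measurable_fst).inter
    (measurableSet_lt (measurable_snd.dist measurable_const) measurable_const)

/-! ## Regular points carry a germ budget -/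

/-- **Germ budget at a regular point.**  For `ν, T > 0`, a classical solution `(u,p)` of unforced
Navier–Stokes on `ℝ³ × [0,T)`, Leray–Hopf on `[0,T]` from its rapidly decaying datum, a level `l`,
a point `x₀` and a radius `r` with `0 < r`, `r² < T` such that `u` is essentially bounded on the
backward cylinder `Q_r(T, x₀) = (T − r², T) × B(x₀, r)`: there are `ρ > 0` and `C` with
`∫_{S_t ∩ {T−ρ ≤ s} × B(x₀,ρ)} |P| ≤ C` (and integrability) for all `t < T`.  Proof: the bound `M`
is pointwise on the open cylinder (continuity); with `ρ₀ = min (r/2) (ν r/2)` (so `ρ₀ ≤ r/2`,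
`ρ₀²/ν ≤ r²/4`) every point `(s,x)` with `T − r²/2 ≤ s < T`, `dist x x₀ < r/2` has its backward
`(ρ₀²/ν, ρ₀)`-cylinder inside `Q_r(T,x₀)`, hence `‖ω(s,x)‖ ≤ K` (`Birth.norm_curl_le_of_slow_cylinder`
at level `M`); `stub_curlBoundedProduction` at `K` pays for the germ region with
`ρ = min (r²/2) (r/2)`. [cite: RobinsonRodrigoSadowskiCUP2016, Thm. 13.7] -/
theorem germBudget_of_cylinderBound {ν T : ℝ} (hν : 0 < ν) (hT : 0 < T)
    {u : ℝ → EuclideanSpace ℝ (Fin 3) → EuclideanSpace ℝ (Fin 3)}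
    {p : ℝ → EuclideanSpace ℝ (Fin 3) → ℝ}
    (hcl : Literature.Analysis.FluidPDE.IsClassicalNSSolutionOn (Set.Ico 0 T) ν 0 u p)
    (hLH : Literature.Analysis.FluidPDE.IsLerayHopfOn T ν 0 (u 0) u)
    (hdec : Literature.Analysis.FluidPDE.HasRapidSpatialDecay (u 0)) (l : ℝ)
    {x₀ : EuclideanSpace ℝ (Fin 3)} {r : ℝ} (hr : 0 < r) (hrT : r ^ 2 < T)
    (hbd : eLpNorm (uncurry u) ∞
      (volume.restrict (parabolicCylinder r ((T : ℝ), x₀))) < ∞) :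
    ∃ ρ : ℝ, 0 < ρ ∧ ∃ C : ℝ, ∀ t ∈ Set.Ico 0 T,
      MeasureTheory.IntegrableOn
        (fun z : ℝ × EuclideanSpace ℝ (Fin 3) =>
          inner ℝ (Literature.Analysis.FluidPDE.curl (u z.1) z.2)
            (fderiv ℝ (u z.1) z.2 (Literature.Analysis.FluidPDE.curl (u z.1) z.2)))
        ({z : ℝ × EuclideanSpace ℝ (Fin 3) | z.1 ∈ Set.Ioo 0 t ∧ ‖u z.1 z.2‖ ≤ l} ∩
          {z : ℝ × EuclideanSpace ℝ (Fin 3) | T - ρ ≤ z.1 ∧ dist z.2 x₀ < ρ}) ∧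
      ∫ z in ({z : ℝ × EuclideanSpace ℝ (Fin 3) | z.1 ∈ Set.Ioo 0 t ∧ ‖u z.1 z.2‖ ≤ l} ∩
          {z : ℝ × EuclideanSpace ℝ (Fin 3) | T - ρ ≤ z.1 ∧ dist z.2 x₀ < ρ}),
        |inner ℝ (Literature.Analysis.FluidPDE.curl (u z.1) z.2)
          (fderiv ℝ (u z.1) z.2 (Literature.Analysis.FluidPDE.curl (u z.1) z.2))| ≤ C := by
  -- the essential bound is pointwise on the open cylinder
  set Q : Set (ℝ × EuclideanSpace ℝ (Fin 3)) := parabolicCylinder r ((T : ℝ), x₀) with hQ_def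
  have hQopen : IsOpen Q := isOpen_parabolicCylinder _ _
  have hQsub : Q ⊆ Ico 0 T ×ˢ (univ : Set (EuclideanSpace ℝ (Fin 3))) := by
    intro z hz
    rw [hQ_def, mem_parabolicCylinder] at hz
    exact mk_mem_prod ⟨by nlinarith [hz.1.1], hz.1.2⟩ (mem_univ _)
  have hcontQ : ContinuousOn (uncurry u) Q := hcl.smooth_velocity.continuousOn.mono hQsub
  obtain ⟨M, hM⟩ := exists_forall_norm_le_of_eLpNorm_lt_top hQopen hcontQ hbd
  -- Serrin's vorticity bound at level `M`, cylinder radius `ρ₀`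
  set ρ₀ : ℝ := min (r / 2) (ν * r / 2) with hρ₀_def
  have hρ₀0 : 0 < ρ₀ := lt_min (by positivity) (by positivity)
  have hρ₀r : ρ₀ ≤ r / 2 := min_le_left _ _
  have hρ₀ν : ρ₀ ^ 2 / ν ≤ r ^ 2 / 4 := by
    rw [div_le_iff₀ hν]
    have h1 : ρ₀ ^ 2 ≤ (r / 2) * (ν * r / 2) := by
      rw [sq]
      exact mul_le_mul hρ₀r (min_le_right _ _) hρ₀0.le (by positivity)
    nlinarith
  have hD := (Literature.Analysis.FluidPDE.IsLerayHopfOn.lintegral_frobeniusNormSq_fderiv_of_classical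
    hcl hLH hT).1
  obtain ⟨K, hK⟩ := Birth.norm_curl_le_of_slow_cylinder ν T hν u p hcl hD M ρ₀ hρ₀0
  obtain ⟨C, hC⟩ := stub_curlBoundedProduction ν T hν hT u p hcl hLH hdec K
  -- the germ region
  set ρ : ℝ := min (r ^ 2 / 2) (r / 2) with hρ_def
  have hρ0 : 0 < ρ := lt_min (by positivity) (by positivity)
  have hρ1 : ρ ≤ r ^ 2 / 2 := min_le_left _ _
  have hρ2 : ρ ≤ r / 2 := min_le_right _ _
  refine ⟨ρ, hρ0, C, fun t ht => hC _ fun z hz => ?_⟩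
  obtain ⟨⟨hzt, -⟩, hzT, hzx⟩ := hz
  have hz1T : z.1 < T := hzt.2.trans ht.2
  refine ⟨⟨hzt.1, hz1T⟩, hK z.1 ?_ hz1T z.2 fun σ hσ y hy => hM (σ, y) ?_⟩
  · -- `ρ₀²/ν ≤ z.1`
    nlinarith [hzT, hρ1, hρ₀ν, hrT]
  · -- the backward cylinder of `(z.1, z.2)` lies in `Q_r(T, x₀)`
    rw [hQ_def, mem_parabolicCylinder]
    refine ⟨⟨?_, lt_of_le_of_lt hσ.2 hz1T⟩, ?_⟩
    · have h1 := hσ.1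
      change T - r ^ 2 < σ
      nlinarith [hzT, hρ1, hρ₀ν]
    · change dist y x₀ < r
      rw [mem_closedBall] at hy
      calc dist y x₀ ≤ dist y z.2 + dist z.2 x₀ := dist_triangle _ _ _
        _ < ρ₀ + ρ := add_lt_add_of_le_of_lt hy hzx
        _ ≤ r / 2 + r / 2 := add_le_add hρ₀r hρ2
        _ = r := by ring

/-! ## Singular germs pay the near field -/

/-- **Near-field budgets from germ budgets at singular points (per solution, per level).**  For
`ν, T > 0`, a classical solution `(u,p)` of unforced Navier–Stokes on `ℝ³ × [0,T)`, Leray–Hopf on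
`[0,T]` from its rapidly decaying datum, and a level `l`: if every point `x₀` that is SINGULAR at
time `T` (`‖u‖_{L^∞(Q_r(T,x₀))} = ∞` for all `0 < r`, `r² < T`) and `l`-SLOW-ACCUMULATING (every germ
region `{T − ρ ≤ s} × B(x₀,ρ)` meets the slow class `{|u| ≤ l}` at some time) has a germ `ρ > 0` on
whose region the slow class carries `∫ |P| ≤ C` uniformly in `t < T`, then for every layer
`h ∈ (0,T)` and radius `R` the slow class inside `{T − h ≤ s} × {‖x‖ < R}` carries `∫ |P| ≤ C'`
uniformly in `t < T`.  Proof: every point has a budgeted germ (slow-accumulating singular: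
hypothesis; other singular: a germ region missing the slow class, budget `0`; regular:
`germBudget_of_cylinderBound`); finitely many germ balls cover the compact `B̄(0,R)`; below the least
germ depth `h₁` (capped at `T/2`) the layer is early and paid by `Birth.stub_slabProduction` on
`(0, T − h₁) × ℝ³`; the rest lies in the finite union of germ regions
(`integrableOn_biUnion_finset_budget`). -/
theorem nearFieldBudget_of_singularGermBudget {ν T : ℝ} (hν : 0 < ν) (hT : 0 < T)
    {u : ℝ → EuclideanSpace ℝ (Fin 3) → EuclideanSpace ℝ (Fin 3)}
    {p : ℝ → EuclideanSpace ℝ (Fin 3) → ℝ}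
    (hcl : Literature.Analysis.FluidPDE.IsClassicalNSSolutionOn (Set.Ico 0 T) ν 0 u p)
    (hLH : Literature.Analysis.FluidPDE.IsLerayHopfOn T ν 0 (u 0) u)
    (hdec : Literature.Analysis.FluidPDE.HasRapidSpatialDecay (u 0)) {l : ℝ}
    (hgerm : ∀ x₀ : EuclideanSpace ℝ (Fin 3),
      (∀ r : ℝ, 0 < r → r ^ 2 < T →
        eLpNorm (uncurry u) ∞ (volume.restrict (parabolicCylinder r ((T : ℝ), x₀))) = ∞) →
      (∀ ρ : ℝ, 0 < ρ → ∃ t ∈ Set.Ico 0 T,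
        ({z : ℝ × EuclideanSpace ℝ (Fin 3) | z.1 ∈ Set.Ioo 0 t ∧ ‖u z.1 z.2‖ ≤ l} ∩
          {z : ℝ × EuclideanSpace ℝ (Fin 3) | T - ρ ≤ z.1 ∧ dist z.2 x₀ < ρ}).Nonempty) →
      ∃ ρ : ℝ, 0 < ρ ∧ ∃ C : ℝ, ∀ t ∈ Set.Ico 0 T,
        MeasureTheory.IntegrableOn
          (fun z : ℝ × EuclideanSpace ℝ (Fin 3) =>
            inner ℝ (Literature.Analysis.FluidPDE.curl (u z.1) z.2)
              (fderiv ℝ (u z.1) z.2 (Literature.Analysis.FluidPDE.curl (u z.1) z.2)))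
          ({z : ℝ × EuclideanSpace ℝ (Fin 3) | z.1 ∈ Set.Ioo 0 t ∧ ‖u z.1 z.2‖ ≤ l} ∩
            {z : ℝ × EuclideanSpace ℝ (Fin 3) | T - ρ ≤ z.1 ∧ dist z.2 x₀ < ρ}) ∧
        ∫ z in ({z : ℝ × EuclideanSpace ℝ (Fin 3) | z.1 ∈ Set.Ioo 0 t ∧ ‖u z.1 z.2‖ ≤ l} ∩
            {z : ℝ × EuclideanSpace ℝ (Fin 3) | T - ρ ≤ z.1 ∧ dist z.2 x₀ < ρ}),
          |inner ℝ (Literature.Analysis.FluidPDE.curl (u z.1) z.2)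
            (fderiv ℝ (u z.1) z.2 (Literature.Analysis.FluidPDE.curl (u z.1) z.2))| ≤ C) :
    ∀ h : ℝ, 0 < h → h < T → ∀ R : ℝ, ∃ C : ℝ, ∀ t ∈ Set.Ico 0 T,
      MeasureTheory.IntegrableOn
        (fun z : ℝ × EuclideanSpace ℝ (Fin 3) =>
          inner ℝ (Literature.Analysis.FluidPDE.curl (u z.1) z.2)
            (fderiv ℝ (u z.1) z.2 (Literature.Analysis.FluidPDE.curl (u z.1) z.2)))
        ({z : ℝ × EuclideanSpace ℝ (Fin 3) | z.1 ∈ Set.Ioo 0 t ∧ ‖u z.1 z.2‖ ≤ l} ∩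
          {z : ℝ × EuclideanSpace ℝ (Fin 3) | T - h ≤ z.1 ∧ ‖z.2‖ < R}) ∧
      ∫ z in ({z : ℝ × EuclideanSpace ℝ (Fin 3) | z.1 ∈ Set.Ioo 0 t ∧ ‖u z.1 z.2‖ ≤ l} ∩
          {z : ℝ × EuclideanSpace ℝ (Fin 3) | T - h ≤ z.1 ∧ ‖z.2‖ < R}),
        |inner ℝ (Literature.Analysis.FluidPDE.curl (u z.1) z.2)
          (fderiv ℝ (u z.1) z.2 (Literature.Analysis.FluidPDE.curl (u z.1) z.2))| ≤ C := by
  intro h _hh _hhT R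
  -- notation
  set P : ℝ × EuclideanSpace ℝ (Fin 3) → ℝ := fun z =>
    inner ℝ (Literature.Analysis.FluidPDE.curl (u z.1) z.2)
      (fderiv ℝ (u z.1) z.2 (Literature.Analysis.FluidPDE.curl (u z.1) z.2)) with hP_def
  set S : ℝ → Set (ℝ × EuclideanSpace ℝ (Fin 3)) := fun t =>
    {z : ℝ × EuclideanSpace ℝ (Fin 3) | z.1 ∈ Set.Ioo 0 t ∧ ‖u z.1 z.2‖ ≤ l} with hS_def
  set G : EuclideanSpace ℝ (Fin 3) → ℝ → Set (ℝ × EuclideanSpace ℝ (Fin 3)) := fun x₀ ρ =>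
    {z : ℝ × EuclideanSpace ℝ (Fin 3) | T - ρ ≤ z.1 ∧ dist z.2 x₀ < ρ} with hG_def
  -- every point has a budgeted germ
  have hpt : ∀ x₀ : EuclideanSpace ℝ (Fin 3), ∃ ρ : ℝ, 0 < ρ ∧ ∃ C : ℝ, ∀ t ∈ Set.Ico 0 T,
      IntegrableOn P (S t ∩ G x₀ ρ) ∧ ∫ z in S t ∩ G x₀ ρ, |P z| ≤ C := by
    intro x₀
    by_cases hsing : ∀ r : ℝ, 0 < r → r ^ 2 < T →
        eLpNorm (uncurry u) ∞ (volume.restrict (parabolicCylinder r ((T : ℝ), x₀))) = ∞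
    · by_cases hacc : ∀ ρ : ℝ, 0 < ρ → ∃ t ∈ Set.Ico 0 T, (S t ∩ G x₀ ρ).Nonempty
      · exact hgerm x₀ hsing hacc
      · -- some germ region misses the slow class at all times: nothing to pay
        push Not at hacc
        obtain ⟨ρ₁, hρ₁, hempty⟩ := hacc
        refine ⟨ρ₁, hρ₁, 0, fun t ht => ?_⟩
        rw [hempty t ht]
        simp
    · push Not at hsing
      obtain ⟨r, hr, hrT, hne⟩ := hsing
      exact germBudget_of_cylinderBound hν hT hcl hLH hdec l hr hrT (lt_top_iff_ne_top.2 hne)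
  choose ρ hρ C hC using hpt
  -- a finite subcover of the compact ball `B̄(0, R)` by germ balls
  have hcover : closedBall (0 : EuclideanSpace ℝ (Fin 3)) R ⊆ ⋃ x₀, ball x₀ (ρ x₀) :=
    fun x _ => mem_iUnion.2 ⟨x, mem_ball_self (hρ x)⟩
  obtain ⟨F, hF⟩ := (isCompact_closedBall (0 : EuclideanSpace ℝ (Fin 3)) R).elim_finite_subcover
    (fun x₀ => ball x₀ (ρ x₀)) (fun _ => isOpen_ball) hcover
  -- the least germ depth, capped at `T/2`
  set F' : Finset (EuclideanSpace ℝ (Fin 3)) := insert 0 F with hF'_def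
  have hF'ne : F'.Nonempty := Finset.insert_nonempty _ _
  set h₁ : ℝ := min (T / 2) (F'.inf' hF'ne ρ) with hh₁_def
  have hh₁0 : 0 < h₁ := lt_min (by positivity) ((Finset.lt_inf'_iff hF'ne).2 fun x _ => hρ x)
  have hh₁T : T - h₁ < T := by linarith
  have hTh₁ : 0 < T - h₁ := by
    have : h₁ ≤ T / 2 := min_le_left _ _
    linarith
  have hh₁ρ : ∀ i ∈ F, h₁ ≤ ρ i := fun i hi =>
    (min_le_right _ _).trans (Finset.inf'_le ρ (Finset.mem_insert_of_mem hi))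
  -- the early slab budget
  have hI : IntegrableOn P (Set.Ioo 0 (T - h₁) ×ˢ (Set.univ : Set (EuclideanSpace ℝ (Fin 3)))) :=
    Birth.stub_slabProduction ν T hν hT u p hcl hLH hdec (T - h₁) hTh₁ hh₁T
  refine ⟨(∫ z in Set.Ioo 0 (T - h₁) ×ˢ (Set.univ : Set (EuclideanSpace ℝ (Fin 3))), |P z|) +
    ∑ i ∈ F, C i, fun t ht => ?_⟩
  change IntegrableOn P (S t ∩ {z : ℝ × EuclideanSpace ℝ (Fin 3) | T - h ≤ z.1 ∧ ‖z.2‖ < R}) ∧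
    ∫ z in S t ∩ {z : ℝ × EuclideanSpace ℝ (Fin 3) | T - h ≤ z.1 ∧ ‖z.2‖ < R}, |P z| ≤ _
  -- measurability of the germ pieces
  have hU : ContinuousOn (uncurry u) (Set.Ico 0 T ×ˢ (Set.univ : Set (EuclideanSpace ℝ (Fin 3)))) :=
    hcl.smooth_velocity.continuousOn
  have hSm : MeasurableSet (S t) := measurableSet_slowClass ht.2.le hU
  have hAm : ∀ i, MeasurableSet (S t ∩ G i (ρ i)) := fun i => hSm.inter (measurableSet_germ T (ρ i) i)
  -- the finite union of germ pieces
  obtain ⟨hUint, hUle⟩ := integrableOn_biUnion_finset_budget (μ := volume) F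
    (fun i => S t ∩ G i (ρ i)) hAm fun i _ => (hC i t ht).1
  have hsum : ∑ i ∈ F, ∫ z in S t ∩ G i (ρ i), |P z| ≤ ∑ i ∈ F, C i :=
    Finset.sum_le_sum fun i _ => (hC i t ht).2
  -- the layer is covered by the early slab and the germ pieces
  have hcov : S t ∩ {z : ℝ × EuclideanSpace ℝ (Fin 3) | T - h ≤ z.1 ∧ ‖z.2‖ < R} ⊆
      (Set.Ioo 0 (T - h₁) ×ˢ (Set.univ : Set (EuclideanSpace ℝ (Fin 3)))) ∪
        ⋃ i ∈ F, (S t ∩ G i (ρ i)) := by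
    intro z hz
    obtain ⟨hzS, -, hzR⟩ := hz
    by_cases hearly : z.1 < T - h₁
    · exact Or.inl (mk_mem_prod ⟨hzS.1.1, hearly⟩ (mem_univ _))
    · right
      have hzball : z.2 ∈ closedBall (0 : EuclideanSpace ℝ (Fin 3)) R := by
        rw [mem_closedBall, dist_zero_right]; exact hzR.le
      obtain ⟨i, hi⟩ := mem_iUnion.1 (hF hzball)
      obtain ⟨hiF, hzi⟩ := mem_iUnion.1 hi
      refine mem_iUnion₂.2 ⟨i, hiF, hzS, ?_, ?_⟩
      · have h1 := hh₁ρ i hiF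
        push Not at hearly
        change T - ρ i ≤ z.1
        linarith
      · exact (mem_ball.1 hzi)
  have hVint : IntegrableOn P ((Set.Ioo 0 (T - h₁) ×ˢ (Set.univ : Set (EuclideanSpace ℝ (Fin 3)))) ∪
      ⋃ i ∈ F, (S t ∩ G i (ρ i))) := hI.union hUint
  refine ⟨hVint.mono_set hcov, ?_⟩
  have hBm : MeasurableSet (⋃ i ∈ F, (S t ∩ G i (ρ i))) :=
    Finset.measurableSet_biUnion F fun i _ => hAm i
  calc ∫ z in S t ∩ {z : ℝ × EuclideanSpace ℝ (Fin 3) | T - h ≤ z.1 ∧ ‖z.2‖ < R}, |P z|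
      ≤ ∫ z in (Set.Ioo 0 (T - h₁) ×ˢ (Set.univ : Set (EuclideanSpace ℝ (Fin 3)))) ∪
          ⋃ i ∈ F, (S t ∩ G i (ρ i)), |P z| :=
        setIntegral_mono_set hVint.abs (ae_of_all _ fun z => abs_nonneg _) hcov.eventuallyLE
    _ ≤ (∫ z in Set.Ioo 0 (T - h₁) ×ˢ (Set.univ : Set (EuclideanSpace ℝ (Fin 3))), |P z|) +
          ∫ z in ⋃ i ∈ F, (S t ∩ G i (ρ i)), |P z| :=
        setIntegral_union_le_add hBm hI.abs hUint.abs fun z => abs_nonneg _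
    _ ≤ _ := by linarith

/-- **The crux from germ budgets at slow-accumulating singular points of maximal solutions.**  If
for every `ν, T > 0`, every MAXIMAL smooth solution `(u,p)` with lifespan `T` that is Leray–Hopf from
its rapidly decaying datum, every level `l > 0` and every point `x₀` that is singular at time `T`
(`‖u‖_{L^∞(Q_r(T,x₀))} = ∞` for all `0 < r`, `r² < T`) and `l`-slow-accumulating (every germ region
`{T − ρ ≤ s} × B(x₀, ρ)` meets the slow class `{|u| ≤ l}`), some germ region, `ρ > 0`, of the slow
class carries `∫ |⟪ω, ∇u ω⟫| ≤ C` uniformly in `t < T`, then `SlowClassProduction` holds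
(`nearFieldBudget_of_singularGermBudget` + `slowClassProduction_of_nearFieldBudget`).  By
`exists_singularPoint_of_classical_of_not_hasSmoothExtensionPast` maximal solutions do have singular
points at `T`; the residue of the crux is thus a LOCAL statement at first-time singularities that are
limits of near-stagnation points `|u| ≤ l` (in the rest frame fixed by the decay at infinity) while
`u` is unbounded nearby — "stagnation-type" singular points. -/
theorem slowClassProduction_of_singularGermBudget :
    (∀ (ν T : ℝ), 0 < ν → 0 < T →
      ∀ (u : ℝ → EuclideanSpace ℝ (Fin 3) → EuclideanSpace ℝ (Fin 3))
        (p : ℝ → EuclideanSpace ℝ (Fin 3) → ℝ),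
        Literature.Analysis.FluidPDE.IsMaximalSmoothSolution ν 0 u p T →
        Literature.Analysis.FluidPDE.IsLerayHopfOn T ν 0 (u 0) u →
        Literature.Analysis.FluidPDE.HasRapidSpatialDecay (u 0) →
        ∀ l : ℝ, 0 < l → ∀ x₀ : EuclideanSpace ℝ (Fin 3),
          (∀ r : ℝ, 0 < r → r ^ 2 < T →
            eLpNorm (Function.uncurry u) ⊤ (MeasureTheory.volume.restrict
              (Literature.Analysis.FluidPDE.parabolicCylinder r ((T : ℝ), x₀))) = ⊤) →
          (∀ ρ : ℝ, 0 < ρ → ∃ t ∈ Set.Ico 0 T,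
            ({z : ℝ × EuclideanSpace ℝ (Fin 3) | z.1 ∈ Set.Ioo 0 t ∧ ‖u z.1 z.2‖ ≤ l} ∩
              {z : ℝ × EuclideanSpace ℝ (Fin 3) | T - ρ ≤ z.1 ∧ dist z.2 x₀ < ρ}).Nonempty) →
          ∃ ρ : ℝ, 0 < ρ ∧ ∃ C : ℝ, ∀ t ∈ Set.Ico 0 T,
            MeasureTheory.IntegrableOn
              (fun z : ℝ × EuclideanSpace ℝ (Fin 3) =>
                inner ℝ (Literature.Analysis.FluidPDE.curl (u z.1) z.2)
                  (fderiv ℝ (u z.1) z.2 (Literature.Analysis.FluidPDE.curl (u z.1) z.2)))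
              ({z : ℝ × EuclideanSpace ℝ (Fin 3) | z.1 ∈ Set.Ioo 0 t ∧ ‖u z.1 z.2‖ ≤ l} ∩
                {z : ℝ × EuclideanSpace ℝ (Fin 3) | T - ρ ≤ z.1 ∧ dist z.2 x₀ < ρ}) ∧
            ∫ z in ({z : ℝ × EuclideanSpace ℝ (Fin 3) | z.1 ∈ Set.Ioo 0 t ∧ ‖u z.1 z.2‖ ≤ l} ∩
                {z : ℝ × EuclideanSpace ℝ (Fin 3) | T - ρ ≤ z.1 ∧ dist z.2 x₀ < ρ}),
              |inner ℝ (Literature.Analysis.FluidPDE.curl (u z.1) z.2)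
                (fderiv ℝ (u z.1) z.2 (Literature.Analysis.FluidPDE.curl (u z.1) z.2))| ≤ C) →
    Summit.NavierStokesRegularity.NavierStokesRegularity.Theses.HodographBetchov.SlowClassProduction := by
  intro hG
  refine slowClassProduction_iff_maximal.mpr ?_
  intro ν T hν hT u p hmax hLH hdec l hl
  exact slowClassBudget_of_nearFieldBudget hν hT hmax.1 hLH hdec
    (nearFieldBudget_of_singularGermBudget hν hT hmax.1 hLH hdec (hG ν T hν hT u p hmax hLH hdec l hl))

end Summit.NavierStokesRegularity.NavierStokesRegularity.Theorems.SlowClassProduction.NearField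

end
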